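import Literature.AlgebraicGeometry.ShimuraVarieties.UnitaryCurveAuxiliaryComplexStructure
import Literature.AlgebraicGeometry.ShimuraVarieties.UnitaryAuxiliaryPeriodEigenrows
import HarnessLib

/-!
# Left `+i`-eigenrows of Deligne's `h(i)` on `V_M ⊗ ℂ` IN ANY RANK `n` (the complexified eigen-census of `J_Φ(v)`, frame-free,
# on the chart `v_k ≠ 0` of the negative cone)

Topic `AlgebraicGeometry/ShimuraVarieties`; namespace `Literature.AlgebraicGeometry.ShimuraVarieties.UnitaryCurve.AuxV`.
Definitions with bodies (`eigRowV`, `censusEmbV`, `dRowV`, `conjRowV`, `censusCoeffV`, `censusRowV`, `censusSlopeV`, `dotLeftL`, `censusDualV`)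
and theorems; no named fact, no instance, no notation, nothing asserted (net debt 0).
Cell `hodgecm-mathlib` (D-0151), FLOOR 0, P6 «MOD programme», door (E) of `stub_RGD`, organ **E2 FILE B** (LEAD F0P6-plan (g2) 2026-09-01T21:40:57Z;
census `F0/P6/A-p17/g27/CENSUS-E2-UnitaryCurveAuxiliaryPeriodMap.v1.A-p17g27.md` §0.4, §1 row B): the rank-`n`, `W₀`-free, frame-free twin of ★ rank-3
`UnitaryAuxiliaryPeriodEigenrows` (namespace `…UnitaryCanonicalModel.Aux`, index `Φ × (Fin 1 ⊕ Fin 3)`, global normalisation `w = (u₀, u₁, 1)` through the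
frame `T`).  `--supports stmt-HodgeConjecture-24832`, count-neutral; HC_CM is proved only modulo the printed citations until rung 0 closes.

`J_Φ(v) = P_ℝ · res_{1⊗b}(B_v) · Q_ℝ` with `B_v = iPhi · s_v ∈ M_n(ℝ ⊗_ℚ M)` (★ FILE A2 `auxComplexStructureV`, ★ `auxRepV`, ★ `coe_blockGLV`).  After base change to
`ℂ` the left eigenrows of `res(B_v)` are read embedding by embedding (★ `vecMul_resMatrix_map`; ★ rank-3 `embOf_basis` reused): a row `c ⊗ r_σ = ((i,l) ↦ c_i σ(b_l))` is a left
`+i`-eigenrow iff `c · σ̃(B_v) = i c`, where `σ̃(B_v) = i · sCompV σ` for `σ ∈ Φ` (★ (E1′)) and `= −i · conj(sCompV σ̄)` for `σ ∉ Φ` (★ (E2′)).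
THIS FILE records the CENSUS of solutions on the CHART `{v_k ≠ 0}` of `ℂⁿ` (pivot `k : Fin n`; `q = v̄ᵀ H^τ v ≠ 0`):

* §1 the conjugate reflection row: `(vᵀ H̄^τ) · conj(r_v) = −(vᵀ H̄^τ)` (`conjRowV v = v ᵥ* (H^τ).map conj`, LINEAR in `v`), `conjRowV v ≠ 0`;
* §2 THE ROWS, indexed by `Φ × Fin n` (cardinal `n·#Φ = g`, FILE C) and AFFINE-LINEAR in `v`:
  for `ρ ∈ Φ` with `ρ∘j ≠ τ`: the standard rows `e_i ⊗ r_ρ` (`i : Fin n`); for `ρ∘j = τ` (`ρ = ρ₀`, unique under ★ `IsExtAdapted`): the `n − 1` rows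
  `d^i(v) ⊗ r_{ρ₀}` (`i ≠ k`), `d^i(v) = v_k e_i − v_i e_k` (so `d^i · v = 0`), and at the PIVOT index `(ρ₀, k)` the CONJUGATE-EMBEDDING row `(vᵀ H̄^τ) ⊗ r_{ρ̄₀}`;
  each is a left `+i`-eigenrow of `res(B_v)_ℂ` (`censusRowV_vecMul_resMatrix`), and each is an eigenrow of the scalar `res(1 ⊗ b)`, `b ∈ M`, with eigenvalue
  `censusEmbV(x)(b)` (`censusRowV_vecMul_resMatrix_scalar` — the Kottwitz∕Lie-type count of GEN's (F2): multiplicity `n` at `ρ ∈ Φ∖{ρ₀}`, `n−1` at `ρ₀`, `1` at `ρ̄₀`);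
  `censusCoeffV_eq_affine`: `c_x(v) = c_x(0) + Σ_a v_a · slope_{a,x}`;
* §3 the rows are linearly independent whenever `v_k ≠ 0` and `q(v) ≠ 0` (`linearIndependent_censusRowV`; ★ `linearIndependent_embeddingRows` + dual functionals
  `censusDualV` inside each fiber of the attached embedding).
For `n = 2`, `k = 1`, `v = (z, 1)` these are the rank-2 analogues of the ★ rows `d⁰ = (1, 0, −u₀)`, `(wᵀJ)T̄⁻¹`.

Consumer: FILE C `UnitaryCurveAuxiliaryPeriodMap` (`Z(v) = siegelOfJ δ (γ J_Φ(v) γ⁻¹) = Δ·R₂(v)⁻¹·R₁(v)` chart-wise, ★ `siegelOfJ_eq_of_leftEigenrows`), whose holomorphy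
on the negative cone is thereby that of a rational function.

## References
* [Deligne1979ShimuraVarieties] P. Deligne, *Variétés de Shimura* (1979), Prop. 2.3.10 (PDF p. 32 of Milne's translation).
* [Deligne1971TravauxShimura] P. Deligne, *Travaux de Shimura*, 1.14–1.15, 4.9 p. 147.
* [Milne2005ShimuraVarieties] J. S. Milne, *Introduction to Shimura varieties* (2005), §8 p. 81.
* [RapoportSmithlingZhang2020Diagonal] M. Rapoport, B. Smithling, W. Zhang, Compos. Math. 156 (2020), Remark 3.2 (ii)(iii), Remark 3.3 p. 10.
-/

set_option autoImplicit false

noncomputable section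

open Matrix NumberField
open scoped TensorProduct ComplexConjugate Classical

namespace Literature.AlgebraicGeometry.ShimuraVarieties

namespace UnitaryCurve

namespace AuxV

open Literature.AlgebraicGeometry.ModuliOfAbelianVarieties
open Literature.AlgebraicGeometry.Motives (CMType)
open Literature.AlgebraicGeometry.ShimuraVarieties.UnitaryCanonicalModel.Aux (ratBasis iPhi iPhiVal coe_iPhi embOf embOf_tmul embOf_basis
  embOf_iPhiVal_of_mem embOf_iPhiVal_of_not_mem)

/-! ### §1. The conjugate reflection row -/

section ConjRow

variable {m : Type} [Fintype m] (Hc : Matrix m m ℂ)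

/-- `conj ∘ (v̄ᵀHc) = vᵀ conj(Hc)` (entrywise conjugate of the row `v̄ᵀ Hc`). [cite: Deligne1979ShimuraVarieties, Prop. 2.3.10 (PDF p. 32)] -/
theorem conj_comp_star_vecMul (v : m → ℂ) :
    (starRingEnd ℂ) ∘ (star v ᵥ* Hc) = v ᵥ* Hc.map (starRingEnd ℂ) := by
  funext i
  rw [Function.comp_apply, RingHom.map_vecMul]
  have hsw : (starRingEnd ℂ) ∘ star v = v := by
    funext l
    simp
  rw [hsw]

/-- `(vᵀ conj(Hc)) · v̄ = conj q(v)`. [cite: Deligne1979ShimuraVarieties, Prop. 2.3.10 (PDF p. 32)] -/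
theorem vecMul_map_conj_dotProduct_star (v : m → ℂ) :
    (v ᵥ* Hc.map (starRingEnd ℂ)) ⬝ᵥ star v = conj (formH Hc v) := by
  rw [← conj_comp_star_vecMul, ← star_vecMul_dotProduct Hc v, RingHom.map_dotProduct]
  congr 1

/-- The conjugate row is non-zero when `q(v) ≠ 0`. [cite: Deligne1979ShimuraVarieties, Prop. 2.3.10 (PDF p. 32)] -/
theorem vecMul_map_conj_ne_zero {v : m → ℂ} (hv : formH Hc v ≠ 0) : v ᵥ* Hc.map (starRingEnd ℂ) ≠ 0 := by
  intro h
  apply hv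
  have h' := vecMul_map_conj_dotProduct_star Hc v
  rw [h, zero_dotProduct] at h'
  exact (map_eq_zero (starRingEnd ℂ)).1 h'.symm

variable [DecidableEq m]

/-- **The row `vᵀ conj(Hc)` is a `(−1)`-eigenrow of the entrywise conjugate `conj(r_v)`** (`q(v) ≠ 0`): the conjugate of ★ FILE A1
`star_vecMul_vecMul_reflH`. [cite: Deligne1979ShimuraVarieties, Prop. 2.3.10 (PDF p. 32)] -/
theorem vecMul_map_conj_vecMul_reflH_map_conj {v : m → ℂ} (hv : formH Hc v ≠ 0) :
    (v ᵥ* Hc.map (starRingEnd ℂ)) ᵥ* (reflH Hc v).map (starRingEnd ℂ) = -(v ᵥ* Hc.map (starRingEnd ℂ)) := by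
  have h := star_vecMul_vecMul_reflH Hc hv
  funext i
  have h3 : (starRingEnd ℂ) (((star v ᵥ* Hc) ᵥ* reflH Hc v) i) =
      (((starRingEnd ℂ) ∘ (star v ᵥ* Hc)) ᵥ* (reflH Hc v).map (starRingEnd ℂ)) i := RingHom.map_vecMul _ _ _ i
  rw [conj_comp_star_vecMul] at h3
  rw [← h3, h, Pi.neg_apply, map_neg, Pi.neg_apply]
  congr 1
  exact congrFun (conj_comp_star_vecMul Hc v) i

end ConjRow

/-! ### §2. The census of eigenrows on the chart `v_k ≠ 0`, indexed by `Φ × Fin n` -/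

section Census

variable {L : Type} [Field L] (M : Type) [Field M] [NumberField M] (Φ : CMType M) (j : L →+* M) (τ : L →+* ℂ)
  {n : ℕ} (H : Matrix (Fin n) (Fin n) L) (k : Fin n)

/-- **The tensor row `c ⊗ r_σ = ((i, l) ↦ c_i · σ(b_l))`** over the `ℚ`-basis `b = ratBasis M` of `M`. [cite: Deligne1971TravauxShimura, 4.9 p. 147] -/
def eigRowV (σ : M →+* ℂ) (c : Fin n → ℂ) : Fin n × Fin (Module.finrank ℚ M) → ℂ :=
  fun p => c p.1 * σ (ratBasis M p.2)

/-- `eigRowV` is additive in the coefficient row. [cite: Deligne1971TravauxShimura, 4.9 p. 147] -/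
theorem eigRowV_add (σ : M →+* ℂ) (c c' : Fin n → ℂ) : eigRowV M σ (c + c') = eigRowV M σ c + eigRowV M σ c' := by
  funext p; simp [eigRowV, add_mul]

/-- `eigRowV` is homogeneous in the coefficient row. [cite: Deligne1971TravauxShimura, 4.9 p. 147] -/
theorem eigRowV_smul (σ : M →+* ℂ) (a : ℂ) (c : Fin n → ℂ) : eigRowV M σ (a • c) = a • eigRowV M σ c := by
  funext p; simp [eigRowV, mul_assoc]

/-- `eigRowV` commutes with finite sums in the coefficient row. [cite: Deligne1971TravauxShimura, 4.9 p. 147] -/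
theorem eigRowV_sum (σ : M →+* ℂ) {ι : Type} (s : Finset ι) (c : ι → Fin n → ℂ) :
    eigRowV M σ (∑ a ∈ s, c a) = ∑ a ∈ s, eigRowV M σ (c a) := by
  funext p; simp [eigRowV, Finset.sum_mul, Finset.sum_apply]

/-- **The embedding attached to the index `(ρ, i)`**: `ρ` itself, except at the PIVOT index `(ρ₀, k)` (`ρ₀ ∘ j = τ`), which carries the CONJUGATE
embedding `ρ̄₀ ∉ Φ`. [cite: Deligne1979ShimuraVarieties, Prop. 2.3.10 (PDF p. 32)] -/
def censusEmbV (ρ : Φ.1) (i : Fin n) : M →+* ℂ :=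
  if ρ.1.comp j = τ ∧ i = k then ComplexEmbedding.conjugate ρ.1 else ρ.1

/-- The rows `d^i(v) = v_k e_i − v_i e_k` (`i ≠ k`): LINEAR in `v`, `d^i · v = 0`, and a basis of `{d ∣ d·v = 0}` when `v_k ≠ 0`.
[cite: Deligne1979ShimuraVarieties, Prop. 2.3.10 (PDF p. 32)] -/
def dRowV (i : Fin n) (v : Fin n → ℂ) : Fin n → ℂ :=
  (v k) • Pi.single i 1 - (v i) • Pi.single k 1

/-- `d^i(v) · v = 0`. [cite: Deligne1979ShimuraVarieties, Prop. 2.3.10 (PDF p. 32)] -/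
theorem dRowV_dotProduct (i : Fin n) (v : Fin n → ℂ) : dRowV k i v ⬝ᵥ v = 0 := by
  rw [dRowV, sub_dotProduct, smul_dotProduct, smul_dotProduct, single_one_dotProduct, single_one_dotProduct, smul_eq_mul,
    smul_eq_mul, mul_comm, sub_self]

/-- The conjugate-embedding coefficient row `vᵀ H̄^τ = v ᵥ* (H^τ).map conj` (LINEAR in `v`). [cite: Deligne1979ShimuraVarieties, Prop. 2.3.10 (PDF p. 32)] -/
def conjRowV (v : Fin n → ℂ) : Fin n → ℂ :=
  v ᵥ* (H.map τ).map (starRingEnd ℂ)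

/-- **The coefficient row attached to `(ρ, i)` at the parameter `v ∈ ℂⁿ`**: for `ρ∘j ≠ τ` the standard row `e_i`; for `ρ∘j = τ`: `d^i(v)` (`i ≠ k`) and
`vᵀ H̄^τ` (`i = k`). [cite: Deligne1979ShimuraVarieties, Prop. 2.3.10 (PDF p. 32)] -/
def censusCoeffV (ρ : Φ.1) (i : Fin n) (v : Fin n → ℂ) : Fin n → ℂ :=
  if ρ.1.comp j = τ then (if i = k then conjRowV τ H v else dRowV k i v) else Pi.single i 1

/-- **The census row** `(ρ, i) ↦ censusCoeffV ⊗ r_{censusEmbV}`. [cite: Deligne1979ShimuraVarieties, Prop. 2.3.10 (PDF p. 32)] -/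
def censusRowV (x : Φ.1 × Fin n) (v : Fin n → ℂ) : Fin n × Fin (Module.finrank ℚ M) → ℂ :=
  eigRowV M (censusEmbV M Φ j τ k x.1 x.2) (censusCoeffV M Φ j τ H k x.1 x.2 v)

/-! #### The census rows are eigenrows of the `σ`-images of `iPhi·s_v` -/

omit [NumberField M] in
/-- `c·(i·S) = i·c` when `c·S = c`. [cite: Deligne1979ShimuraVarieties, Prop. 2.3.10 (PDF p. 32)] -/
theorem vecMul_I_smul_of_vecMul_eq {S : Matrix (Fin n) (Fin n) ℂ} {c : Fin n → ℂ} (h : c ᵥ* S = c) :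
    c ᵥ* (Complex.I • S) = Complex.I • c := by
  rw [Matrix.vecMul_smul, h]

omit [NumberField M] in
/-- `c·(−i·S') = i·c` when `c·S' = −c`. [cite: Deligne1979ShimuraVarieties, Prop. 2.3.10 (PDF p. 32)] -/
theorem vecMul_neg_I_smul_of_vecMul_eq_neg {S' : Matrix (Fin n) (Fin n) ℂ} {c : Fin n → ℂ} (h : c ᵥ* S' = -c) :
    c ᵥ* ((-Complex.I) • S') = Complex.I • c := by
  rw [Matrix.vecMul_smul, h, smul_neg, neg_smul, neg_neg]

/-- **Each census coefficient row is a left `+i`-eigenrow of the corresponding `σ`-image of `B_v = iPhi·s_v`** (`q(v) ≠ 0`): (E1′)/(E2′) of ★ FILE A2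
with the row facts of ★ FILE A1 and §1. [cite: Deligne1979ShimuraVarieties, Prop. 2.3.10 (PDF p. 32)] -/
theorem censusCoeffV_vecMul_blockGLV_map {v : Fin n → ℂ} (hv : formH (H.map τ) v ≠ 0) (x : Φ.1 × Fin n) :
    censusCoeffV M Φ j τ H k x.1 x.2 v ᵥ*
        (((blockGLV (ℝ ⊗[ℚ] M) (iPhi M Φ, sPhiV M j Φ τ H v) : GL (Fin n) (ℝ ⊗[ℚ] M)) :
          Matrix (Fin n) (Fin n) (ℝ ⊗[ℚ] M)).map (embOf M (censusEmbV M Φ j τ k x.1 x.2))) =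
      Complex.I • censusCoeffV M Φ j τ H k x.1 x.2 v := by
  obtain ⟨ρ, i⟩ := x
  by_cases hρ : ρ.1.comp j = τ
  · by_cases hi : i = k
    · -- the conjugate-embedding row at the pivot
      subst hi
      have hemb : censusEmbV M Φ j τ i ρ i = ComplexEmbedding.conjugate ρ.1 := by
        simp [censusEmbV, hρ]
      have hc : censusCoeffV M Φ j τ H i ρ i v = conjRowV τ H v := by
        simp [censusCoeffV, hρ]
      have hnot : ComplexEmbedding.conjugate ρ.1 ∉ Φ.1 := (Φ.2 ρ.1).1 ρ.2
      have hinv : ComplexEmbedding.conjugate (ComplexEmbedding.conjugate ρ.1) = ρ.1 :=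
        ComplexEmbedding.involutive_conjugate M ρ.1
      have hcc : ComplexEmbedding.conjugate (ComplexEmbedding.conjugate ρ.1) ∈ Φ.1 := by
        rw [hinv]; exact ρ.2
      dsimp only
      rw [hemb, hc, coe_blockGLV_iPhi_sPhiV_map_embOf_of_not_mem M j Φ τ H hnot hcc v]
      have hρ' : (⟨ComplexEmbedding.conjugate (ComplexEmbedding.conjugate ρ.1), hcc⟩ : Φ.1) = ρ := Subtype.ext hinv
      rw [hρ', sCompV_of_eq _ hρ]
      exact vecMul_neg_I_smul_of_vecMul_eq_neg (vecMul_map_conj_vecMul_reflH_map_conj (H.map τ) hv)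
    · -- the rows `d^i(v)`, `i ≠ k`
      have hemb : censusEmbV M Φ j τ k ρ i = ρ.1 := by
        simp [censusEmbV, hi]
      have hc : censusCoeffV M Φ j τ H k ρ i v = dRowV k i v := by
        simp [censusCoeffV, hρ, hi]
      dsimp only
      rw [hemb, hc, coe_blockGLV_iPhi_sPhiV_map_embOf_of_mem M j Φ τ H ρ.2 v, sCompV_of_eq _ hρ]
      exact vecMul_I_smul_of_vecMul_eq (vecMul_reflH_of_dotProduct_eq_zero (H.map τ) (dRowV_dotProduct k i v))
  · -- off `τ`: `sCompV = 1`, every standard row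
    have hemb : censusEmbV M Φ j τ k ρ i = ρ.1 := by
      simp [censusEmbV, hρ]
    have hc : censusCoeffV M Φ j τ H k ρ i v = Pi.single i 1 := by
      simp [censusCoeffV, hρ]
    dsimp only
    rw [hemb, hc, coe_blockGLV_iPhi_sPhiV_map_embOf_of_mem M j Φ τ H ρ.2 v, sCompV_of_ne _ hρ]
    exact vecMul_I_smul_of_vecMul_eq (by rw [Matrix.vecMul_one])

/-! #### … hence left `+i`-eigenrows of the complexified restriction of scalars `res(B_v)_ℂ` -/

/-- `eigRowV σ c` is the row `c ⊗ r_{embOf σ}` of ★ `vecMul_resMatrix_map` for the basis `1 ⊗ b`. [cite: Deligne1971TravauxShimura, 4.9 p. 147] -/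
theorem eigRowV_eq (σ : M →+* ℂ) (c : Fin n → ℂ) :
    eigRowV M σ c = fun p => c p.1 * embOf M σ (Algebra.TensorProduct.basis ℝ (ratBasis M) p.2) := by
  funext p; rw [eigRowV, embOf_basis]

/-- **`eigRowV σ c` is a left `μ`-eigenrow of `res(B)_ℂ` whenever `c·σ̃(B) = μ·c`.** [cite: Deligne1971TravauxShimura, 4.9 p. 147] -/
theorem eigRowV_vecMul_resMatrix_of_vecMul_eq_smul (σ : M →+* ℂ) {c : Fin n → ℂ} {μ : ℂ}
    (B : Matrix (Fin n) (Fin n) (ℝ ⊗[ℚ] M)) (hc : c ᵥ* B.map (embOf M σ) = μ • c) :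
    eigRowV M σ c ᵥ* (resMatrix (Algebra.TensorProduct.basis ℝ (ratBasis M)) B).map (algebraMap ℝ ℂ) = μ • eigRowV M σ c := by
  rw [eigRowV_eq]
  exact vecMul_resMatrix_map_of_vecMul_eq_smul _ (embOf M σ) B hc

/-- **Every census row is a left `+i`-eigenrow of `res(B_v)_ℂ`** (`q(v) ≠ 0`). [cite: Deligne1979ShimuraVarieties, Prop. 2.3.10 (PDF p. 32)] -/
theorem censusRowV_vecMul_resMatrix {v : Fin n → ℂ} (hv : formH (H.map τ) v ≠ 0) (x : Φ.1 × Fin n) :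
    censusRowV M Φ j τ H k x v ᵥ*
        (resMatrix (Algebra.TensorProduct.basis ℝ (ratBasis M))
          (((blockGLV (ℝ ⊗[ℚ] M) (iPhi M Φ, sPhiV M j Φ τ H v) : GL (Fin n) (ℝ ⊗[ℚ] M)) :
            Matrix (Fin n) (Fin n) (ℝ ⊗[ℚ] M)))).map (algebraMap ℝ ℂ) =
      Complex.I • censusRowV M Φ j τ H k x v :=
  eigRowV_vecMul_resMatrix_of_vecMul_eq_smul M _ _ (censusCoeffV_vecMul_blockGLV_map M Φ j τ H k hv x)

/-- **Every census row is an eigenrow of the scalar `res(1 ⊗ b)`, `b ∈ M`, with eigenvalue `censusEmbV(x)(b)`** — the Lie-type count of the `M`-action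
read on the `+i`-eigenrows: multiplicity `n` at `ρ ∈ Φ∖{ρ₀}`, `n−1` at `ρ₀`, `1` at `ρ̄₀` (GEN's (F2)). [cite: Deligne1979ShimuraVarieties, Prop. 2.3.10 (PDF p. 32)]
[cite: RapoportSmithlingZhang2020Diagonal, §3.2 (3.8) p. 11] -/
theorem censusRowV_vecMul_resMatrix_scalar (v : Fin n → ℂ) (x : Φ.1 × Fin n) (b : M) :
    censusRowV M Φ j τ H k x v ᵥ*
        (resMatrix (Algebra.TensorProduct.basis ℝ (ratBasis M))
          (((Algebra.TensorProduct.includeRight : M →ₐ[ℚ] ℝ ⊗[ℚ] M) b) • (1 : Matrix (Fin n) (Fin n) (ℝ ⊗[ℚ] M)))).map (algebraMap ℝ ℂ) =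
      (censusEmbV M Φ j τ k x.1 x.2 b) • censusRowV M Φ j τ H k x v := by
  refine eigRowV_vecMul_resMatrix_of_vecMul_eq_smul M _ _ ?_
  rw [smul_map, Matrix.map_one _ (map_zero _) (map_one _), Algebra.TensorProduct.includeRight_apply, embOf_tmul, Complex.ofReal_one,
    one_mul, Matrix.vecMul_smul, Matrix.vecMul_one]

/-! #### The rows are affine in `v` -/

/-- The `v_a`-slope of the coefficient row of index `(ρ, i)`: over `τ`, `e_a ᵥ* H̄^τ` at the pivot `i = k`, `δ_{ak} e_i − δ_{ai} e_k` at `i ≠ k`; `0` off `τ`.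
[cite: Deligne1979ShimuraVarieties, Prop. 2.3.10 (PDF p. 32)] -/
def censusSlopeV (a : Fin n) (ρ : Φ.1) (i : Fin n) : Fin n → ℂ :=
  if ρ.1.comp j = τ then
    (if i = k then Pi.single a 1 ᵥ* (H.map τ).map (starRingEnd ℂ)
     else (if a = k then Pi.single i 1 else 0) - (if a = i then Pi.single k 1 else 0))
  else 0

omit [NumberField M] in
/-- `vᵀ H̄^τ = Σ_a v_a · (e_aᵀ H̄^τ)` and `0ᵀ H̄^τ = 0`. [cite: Deligne1979ShimuraVarieties, Prop. 2.3.10 (PDF p. 32)] -/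
theorem conjRowV_eq_sum (v : Fin n → ℂ) :
    conjRowV τ H v = conjRowV τ H 0 + ∑ a, v a • (Pi.single a 1 ᵥ* (H.map τ).map (starRingEnd ℂ)) := by
  rw [conjRowV, conjRowV, Matrix.zero_vecMul, zero_add]
  conv_lhs => rw [pi_eq_sum_univ' v]
  rw [Matrix.sum_vecMul]
  refine Finset.sum_congr rfl fun a _ => ?_
  rw [Matrix.smul_vecMul]

omit [NumberField M] in
/-- `d^i(v) = Σ_a v_a · (δ_{ak} e_i − δ_{ai} e_k)` and `d^i(0) = 0`. [cite: Deligne1979ShimuraVarieties, Prop. 2.3.10 (PDF p. 32)] -/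
theorem dRowV_eq_sum (i : Fin n) (v : Fin n → ℂ) :
    dRowV k i v = dRowV k i 0 + ∑ a, v a • ((if a = k then Pi.single i 1 else 0) - (if a = i then Pi.single k 1 else 0) : Fin n → ℂ) := by
  have h0 : dRowV k i 0 = 0 := by simp [dRowV]
  rw [h0, zero_add]
  simp only [smul_sub, Finset.sum_sub_distrib, smul_ite, smul_zero, Finset.sum_ite_eq', Finset.mem_univ, if_true]
  rfl

omit [NumberField M] in
/-- **The coefficient rows are affine in `v`**: `c_x(v) = c_x(0) + Σ_a v_a · slope_{a,x}`. [cite: Deligne1979ShimuraVarieties, Prop. 2.3.10 (PDF p. 32)] -/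
theorem censusCoeffV_eq_affine (ρ : Φ.1) (i : Fin n) (v : Fin n → ℂ) :
    censusCoeffV M Φ j τ H k ρ i v = censusCoeffV M Φ j τ H k ρ i 0 + ∑ a, v a • censusSlopeV M Φ j τ H k a ρ i := by
  by_cases hρ : ρ.1.comp j = τ
  · by_cases hi : i = k
    · simp only [censusCoeffV, censusSlopeV, hρ, hi, if_true]
      exact conjRowV_eq_sum τ H v
    · simp only [censusCoeffV, censusSlopeV, hρ, hi, if_true, if_false]
      exact dRowV_eq_sum k i v
  · simp [censusCoeffV, censusSlopeV, hρ]

/-- **The census rows are affine in `v`**: `row_x(v) = row_x(0) + Σ_a v_a · A_{a,x}` with `A_{a,x} = eigRowV (censusEmbV x) (censusSlopeV a x)`.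
[cite: Deligne1979ShimuraVarieties, Prop. 2.3.10 (PDF p. 32)] -/
theorem censusRowV_eq_affine (x : Φ.1 × Fin n) (v : Fin n → ℂ) :
    censusRowV M Φ j τ H k x v = censusRowV M Φ j τ H k x 0 +
      ∑ a, v a • eigRowV M (censusEmbV M Φ j τ k x.1 x.2) (censusSlopeV M Φ j τ H k a x.1 x.2) := by
  rw [censusRowV, censusRowV, censusCoeffV_eq_affine M Φ j τ H k x.1 x.2 v, eigRowV_add, eigRowV_sum]
  congr 1
  refine Finset.sum_congr rfl fun a _ => ?_
  rw [eigRowV_smul]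

/-! ### §3. Linear independence of the census rows on the chart `v_k ≠ 0` -/

omit [NumberField M] in
/-- Two indices with the same attached embedding have the same `Φ`-component and the same «pivot» status.
[cite: Deligne1979ShimuraVarieties, Prop. 2.3.10 (PDF p. 32)] -/
theorem eq_of_censusEmbV_eq {ρ ρ' : Φ.1} {i i' : Fin n}
    (h : censusEmbV M Φ j τ k ρ' i' = censusEmbV M Φ j τ k ρ i) :
    ρ' = ρ ∧ ((ρ.1.comp j = τ ∧ i = k) ↔ (ρ'.1.comp j = τ ∧ i' = k)) := by
  unfold censusEmbV at h
  by_cases h1 : ρ'.1.comp j = τ ∧ i' = k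
  · by_cases h2 : ρ.1.comp j = τ ∧ i = k
    · rw [if_pos h1, if_pos h2] at h
      have : ρ'.1 = ρ.1 := (ComplexEmbedding.involutive_conjugate M).injective h
      exact ⟨Subtype.ext this, ⟨fun _ => h1, fun _ => h2⟩⟩
    · rw [if_pos h1, if_neg h2] at h
      exact absurd (h ▸ ρ.2) ((Φ.2 ρ'.1).1 ρ'.2)
  · by_cases h2 : ρ.1.comp j = τ ∧ i = k
    · rw [if_neg h1, if_pos h2] at h
      exact absurd (h.symm ▸ ρ'.2) ((Φ.2 ρ.1).1 ρ.2)
    · rw [if_neg h1, if_neg h2] at h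
      exact ⟨Subtype.ext h, ⟨fun h' => absurd h' h2, fun h' => absurd h' h1⟩⟩

omit [NumberField M] in
/-- The linear functional `c ↦ c · w` on rows. [cite: Deligne1971TravauxShimura, 4.9 p. 147] -/
def dotLeftL (w : Fin n → ℂ) : (Fin n → ℂ) →ₗ[ℂ] ℂ where
  toFun c := c ⬝ᵥ w
  map_add' c c' := add_dotProduct c c' w
  map_smul' r c := by rw [smul_dotProduct, RingHom.id_apply]

omit [NumberField M] in
/-- Unfolding of `dotLeftL`. [cite: Deligne1971TravauxShimura, 4.9 p. 147] -/
@[simp] theorem dotLeftL_apply (w c : Fin n → ℂ) : dotLeftL w c = c ⬝ᵥ w := rfl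

/-- **The dual functionals of the census at the parameter `v`** (index `(ρ, i)`): evaluation at `i` off `τ`; over `τ`, `(v_k)⁻¹ ·` evaluation at `i`
for `i ≠ k`, and `c ↦ (c · v̄)/conj q(v)` at the pivot `i = k`. [cite: Deligne1979ShimuraVarieties, Prop. 2.3.10 (PDF p. 32)] -/
def censusDualV (v : Fin n → ℂ) (ρ : Φ.1) (i : Fin n) : (Fin n → ℂ) →ₗ[ℂ] ℂ :=
  if ρ.1.comp j = τ then
    (if i = k then (conj (formH (H.map τ) v))⁻¹ • dotLeftL (star v) else (v k)⁻¹ • LinearMap.proj i)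
  else LinearMap.proj i

omit [NumberField M] in
/-- **Biorthogonality**: within a fiber of `censusEmbV`, `Λ_{x₀}(c_x(v)) = δ_{x x₀}` (`v_k ≠ 0`, `q(v) ≠ 0`). [cite: Deligne1979ShimuraVarieties, Prop. 2.3.10 (PDF p. 32)] -/
theorem censusDualV_censusCoeffV {v : Fin n → ℂ} (hk : v k ≠ 0) (hv : formH (H.map τ) v ≠ 0) (x₀ x : Φ.1 × Fin n)
    (h : censusEmbV M Φ j τ k x.1 x.2 = censusEmbV M Φ j τ k x₀.1 x₀.2) :
    censusDualV M Φ j τ H k v x₀.1 x₀.2 (censusCoeffV M Φ j τ H k x.1 x.2 v) = if x = x₀ then 1 else 0 := by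
  obtain ⟨ρ, i₀⟩ := x₀
  obtain ⟨ρ', i⟩ := x
  dsimp only at h ⊢
  obtain ⟨hρρ, hiff⟩ := eq_of_censusEmbV_eq M Φ j τ k h
  subst ρ'
  by_cases hρ : ρ.1.comp j = τ
  · by_cases hi₀ : i₀ = k
    · -- pivot functional; then `x` is the pivot too
      subst hi₀
      have hi : i = i₀ := (hiff.1 ⟨hρ, rfl⟩).2
      subst hi
      rw [if_pos rfl]
      simp only [censusDualV, censusCoeffV, hρ, if_true, LinearMap.smul_apply, dotLeftL_apply, conjRowV,
        vecMul_map_conj_dotProduct_star, smul_eq_mul]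
      exact inv_mul_cancel₀ ((map_ne_zero _).2 hv)
    · -- `x₀ = (ρ, i₀)`, `i₀ ≠ k`; then `i ≠ k`
      have hi : i ≠ k := fun hi => hi₀ (hiff.2 ⟨hρ, hi⟩).2
      by_cases hii : i = i₀
      · subst hii
        rw [if_pos rfl]
        simp only [censusDualV, censusCoeffV, hρ, hi, if_true, if_false, LinearMap.smul_apply, LinearMap.coe_proj,
          Function.eval, dRowV, Pi.sub_apply, Pi.smul_apply, Pi.single_eq_same, Pi.single_eq_of_ne hi, smul_eq_mul,
          mul_one, mul_zero, sub_zero]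
        exact inv_mul_cancel₀ hk
      · have hne : ((ρ, i) : Φ.1 × Fin n) ≠ (ρ, i₀) := by simpa using hii
        rw [if_neg hne]
        simp only [censusDualV, censusCoeffV, hρ, hi, hi₀, if_true, if_false, LinearMap.smul_apply, LinearMap.coe_proj,
          Function.eval, dRowV, Pi.sub_apply, Pi.smul_apply, Pi.single_eq_of_ne (Ne.symm hii), Pi.single_eq_of_ne hi₀,
          smul_eq_mul, mul_zero, sub_zero]
  · -- off `τ`: standard rows and evaluations
    by_cases hii : i = i₀
    · subst hii; simp [censusDualV, censusCoeffV, hρ]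
    · have hne : ((ρ, i) : Φ.1 × Fin n) ≠ (ρ, i₀) := by simpa using hii
      rw [if_neg hne]
      simp [censusDualV, censusCoeffV, hρ, hii]

/-- **The census rows are linearly independent, for every parameter `v` with `v_k ≠ 0` and `q(v) ≠ 0`.**  Group a vanishing combination by the
attached embedding (★ `linearIndependent_embeddingRows`: the rows `r_σ = (σ(b_l))_l` are independent), then apply the dual functionals `censusDualV`
inside each fiber. [cite: Deligne1979ShimuraVarieties, Prop. 2.3.10 (PDF p. 32)] -/
theorem linearIndependent_censusRowV {v : Fin n → ℂ} (hk : v k ≠ 0) (hv : formH (H.map τ) v ≠ 0) :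
    LinearIndependent ℂ (fun x : Φ.1 × Fin n => censusRowV M Φ j τ H k x v) := by
  classical
  rw [Fintype.linearIndependent_iff]
  intro a ha x₀
  -- Step 1: inside each fiber of `censusEmbV` the coefficient rows combine to zero
  have hfib : ∀ σ : M →+* ℂ,
      ∑ x ∈ Finset.univ.filter (fun x : Φ.1 × Fin n => censusEmbV M Φ j τ k x.1 x.2 = σ),
        a x • censusCoeffV M Φ j τ H k x.1 x.2 v = 0 := by
    intro σ
    funext i
    have hr := Fintype.linearIndependent_iff.1 (linearIndependent_embeddingRows M (ratBasis M))
      (fun σ' => ∑ x ∈ Finset.univ.filter (fun x : Φ.1 × Fin n => censusEmbV M Φ j τ k x.1 x.2 = σ'),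
        a x * censusCoeffV M Φ j τ H k x.1 x.2 v i) ?_ σ
    · simpa only [Finset.sum_apply, Pi.smul_apply, smul_eq_mul, Pi.zero_apply] using hr
    · funext l
      have h := congrFun ha (i, l)
      simp only [Finset.sum_apply, Pi.smul_apply, smul_eq_mul, Pi.zero_apply, censusRowV, eigRowV] at h
      simp only [Finset.sum_apply, Pi.smul_apply, smul_eq_mul, Pi.zero_apply]
      rw [← h, ← Finset.sum_fiberwise Finset.univ (fun x : Φ.1 × Fin n => censusEmbV M Φ j τ k x.1 x.2)]
      refine Finset.sum_congr rfl fun σ' _ => ?_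
      rw [Finset.sum_mul]
      refine Finset.sum_congr rfl fun x hx => ?_
      rw [(Finset.mem_filter.1 hx).2, mul_assoc]
  -- Step 2: apply the dual functional of `x₀` inside its own fiber
  have h2 := congrArg (censusDualV M Φ j τ H k v x₀.1 x₀.2) (hfib (censusEmbV M Φ j τ k x₀.1 x₀.2))
  rw [map_sum, map_zero] at h2
  have h3 : ∑ x ∈ Finset.univ.filter
      (fun x : Φ.1 × Fin n => censusEmbV M Φ j τ k x.1 x.2 = censusEmbV M Φ j τ k x₀.1 x₀.2),
      a x * (if x = x₀ then (1 : ℂ) else 0) = 0 := by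
    refine Eq.trans (Finset.sum_congr rfl fun x hx => ?_) h2
    rw [map_smul, smul_eq_mul, censusDualV_censusCoeffV M Φ j τ H k hk hv x₀ x (Finset.mem_filter.1 hx).2]
  have hx₀ : x₀ ∈ Finset.univ.filter
      (fun x : Φ.1 × Fin n => censusEmbV M Φ j τ k x.1 x.2 = censusEmbV M Φ j τ k x₀.1 x₀.2) :=
    Finset.mem_filter.2 ⟨Finset.mem_univ _, rfl⟩
  simp only [mul_ite, mul_one, mul_zero] at h3
  rw [Finset.sum_ite_eq' _ x₀, if_pos hx₀] at h3
  exact h3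

end Census

end AuxV

end UnitaryCurve

end Literature.AlgebraicGeometry.ShimuraVarieties

end
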